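import Summits.BirchSwinnertonDyer.Rank1Residual.X2.ParitySqueeze
import HarnessLib

/-!
# Route P at `p ‖ N` — headline forms: the split / non-split main-conjecture certificates,
# `BSD(E,p)`, and the sub-cell X2b statements (cell `b2b-bsdres`, unit `b2b-bsdres-eisenstein-p2`, gen 4)

HONEST FRAMING (run/shared/lean/b2b/bsd-rank1-residual/, verbatim in every file): the goal of the
cell is to DELETE the COMBINATION-SHAPED residual classes of the Birch–Swinnerton-Dyer formula for
ALL analytic-rank `≤ 1` elliptic curves over `ℚ` — "full BSD formula for every rank `≤ 1` curve in
class `C`" assembled STRICTLY from published theorems — so that the rank-`≤ 1` remainder becomes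
exactly the CONSTRUCTION-SHAPED classes, which are TYPED (missing-input `Prop`s), NOT attempted.
This is not "finishing BSD". Research routes; NO CLAIM BEYOND STATED CLASSES; nothing here changes
a label; sub-cell X2b stays CONSTRUCTION-SHAPED. Theorems only (no definition, no named fact).

Contents (all from `X2.mazurMainConjectureAt_of_routeP`, `X2/ParitySqueeze.lean`, and gen 1's
`X2.bsdp_of_mazurMainConjectureAt_of_analyticRank_eq_zero`):
* `mazurMainConjectureAt_of_lamTwo_of_nonsplit` — **non-split `p`: `μ_an = 0 ∧ λ_an = 2 ∧
  2·ord_p #E(ℚ)_tors < ord_p ∏_ℓ c_ℓ ⇒` Mazur's main conjecture at `(E,p)`**;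
* `mazurMainConjectureAt_of_lamThree_of_split` — **split `p`: `μ_an = 0 ∧ λ_an = 3 ∧
  k ≤ ord_p 𝓛_p(E) ∧ 2 + 2·ord_p #E(ℚ)_tors ≤ k + ord_p ∏_ℓ c_ℓ ⇒` Mazur's main conjecture**;
* the `BSD(E,p)` versions and the no-rational-`p`-torsion specialisations
  (`… 2·ord_p #tors = 0`: non-split `p ∣ ∏ c_ℓ`; split `2 ≤ k + ord_p ∏ c_ℓ`);
* `CellB` (sub-cell X2b) forms: the typed missing input `X2.MissingInputB W p` and `BSDp W p` from
  the route-P data.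
Per-pair certificates; the class-level input of X2b is untouched. Which isogeny-class member has
`μ_an = 0` is a per-class datum; `X2.mazurMainConjectureAt_of_isIsogenous` (p204056) and
`Wuthrich2014.bsdp_of_isIsogenous` move the conclusions along the class.

References: [GreenbergLNM1716] Prop. 3.10, §5 p. 183; [Wuthrich2014] Thm. 16; [SteinWuthrich2013]
Thm. 6.1; [GreenbergStevens1993]; HOME/b2b-bsdres-eisenstein-p2/X2-GAP.md §9.
-/

set_option autoImplicit false

noncomputable section

open scoped Classical MatrixGroups ModularForm

open CongruenceSubgroup WeierstrassCurve Literature.NumberTheory.EllipticCurves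
  Literature.NumberTheory.EllipticCurves.ModularForms
  Literature.NumberTheory.EllipticCurves.Rank1Residual
  Literature.NumberTheory.EllipticCurves.Rank1Residual.Typed
  Literature.NumberTheory.EllipticCurves.Wuthrich2014
  Literature.NumberTheory.EllipticCurves.SteinWuthrich2013
  Literature.NumberTheory.EllipticCurves.Greenberg1999

namespace Summit.BirchSwinnertonDyer.Rank1Residual.X2

section Headline

variable {W : WeierstrassCurve ℚ} [W.IsElliptic] [W.IsGloballyMinimal] {p : ℕ} [Fact p.Prime]

/-- **Route P at a NON-SPLIT multiplicative Eisenstein prime: `μ_an = 0 ∧ λ_an = 2 ∧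
2·ord_p #E(ℚ)_tors < ord_p ∏_ℓ c_ℓ ⇒` Mazur's main conjecture at `(E,p)`** (`W/ℚ` globally minimal,
`p ≠ 2` non-split multiplicative, `E[p]` reducible, `ord_{s=1}L(E,s) = 0`; PUBLISHED named facts as
hypotheses; `hGS` is carried for the uniform interface). [cite: GreenbergLNM1716, Prop. 3.10 and §5 p. 183 (Conductor = 147, p = 13)]
[cite: Wuthrich2014, Thm. 16 (p. 397)] [cite: SteinWuthrich2013, Thm. 6.1 (p. 20), §3.1 (p. 9)] -/
theorem mazurMainConjectureAt_of_lamTwo_of_nonsplit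
    (hWu : thm16_charIdeal_dvd_multiplicative_of_reducible)
    (hJs : thm61_splitMultiplicative) (hJn : thm61_nonsplitMultiplicative)
    (hHs : exists_isSplitMultCanonical) (hHn : exists_isMultCanonical)
    (h310 : prop310_selmerCorank_mod_two_eq_lambdaInvariant)
    (hGZK : rank_eq_analyticRank_of_analyticRank_le_one) (hmod : hasEntireLFunction_rat)
    (W : WeierstrassCurve ℚ) [W.IsElliptic] [W.IsGloballyMinimal] (p : ℕ) [Fact p.Prime]
    (hGS : greenberg_stevens (W := W) (p := p))
    (hp2 : p ≠ 2) (hmult : W.HasMultiplicativeReductionAtPrime p)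
    (hns : ¬ W.HasSplitMultiplicativeReductionAtPrime p)
    (hred : ¬ W.HasIrreducibleModPGaloisRep p) (hr : W.analyticRank = 0)
    (hμ0 : AnalyticMuLE W p 0) (hlam2 : AnalyticLambdaEq W p 2)
    (hb : 2 * padicValNat p W.torsionOrder < padicValNat p W.tamagawaProduct) :
    X2.MazurMainConjectureAt W p :=
  mazurMainConjectureAt_of_routeP hWu hJs hJn hHs hHn h310 hGZK hmod W p hGS hp2 hmult hred hr hμ0
    (fun _ ↦ hlam2) (fun _ ↦ hb) (fun hs ↦ absurd hs hns) (fun hs ↦ absurd hs hns)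

/-- **Route P at a SPLIT multiplicative Eisenstein prime: `μ_an = 0 ∧ λ_an = 3 ∧ k ≤ ord_p 𝓛_p(E) ∧
2 + 2·ord_p #E(ℚ)_tors ≤ k + ord_p ∏_ℓ c_ℓ ⇒` Mazur's main conjecture at `(E,p)`** (`W/ℚ` globally
minimal, `p ≠ 2` split multiplicative, `E[p]` reducible, `ord_{s=1}L(E,s) = 0`; `𝓛_p = log_p q_E /
ord_p q_E` the tree's `LInvariant`; `λ_an` counts the trivial zero). [cite: GreenbergLNM1716, Prop. 3.10 and §5 p. 183 (Conductor = 147, p = 13)]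
[cite: Wuthrich2014, Thm. 16 (p. 397)] [cite: SteinWuthrich2013, Thm. 6.1 (p. 20), eq. (3.4) (p. 11)]
[cite: GreenbergStevens1993, Thm. (trivial zero)] -/
theorem mazurMainConjectureAt_of_lamThree_of_split
    (hWu : thm16_charIdeal_dvd_multiplicative_of_reducible)
    (hJs : thm61_splitMultiplicative) (hJn : thm61_nonsplitMultiplicative)
    (hHs : exists_isSplitMultCanonical) (hHn : exists_isMultCanonical)
    (h310 : prop310_selmerCorank_mod_two_eq_lambdaInvariant)
    (hGZK : rank_eq_analyticRank_of_analyticRank_le_one) (hmod : hasEntireLFunction_rat)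
    (W : WeierstrassCurve ℚ) [W.IsElliptic] [W.IsGloballyMinimal] (p : ℕ) [Fact p.Prime]
    (hGS : greenberg_stevens (W := W) (p := p))
    (hp2 : p ≠ 2) (hsplit : W.HasSplitMultiplicativeReductionAtPrime p)
    (hred : ¬ W.HasIrreducibleModPGaloisRep p) (hr : W.analyticRank = 0)
    (hμ0 : AnalyticMuLE W p 0) (hlam3 : AnalyticLambdaEq W p 3)
    {k : ℤ} (h𝓛 : ∀ Dq : TateParameterData W p, k ≤ (LInvariant Dq).valuation)
    (hb : 2 + 2 * (padicValNat p W.torsionOrder : ℤ) ≤ k + padicValNat p W.tamagawaProduct) :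
    X2.MazurMainConjectureAt W p :=
  mazurMainConjectureAt_of_routeP hWu hJs hJn hHs hHn h310 hGZK hmod W p hGS hp2 hsplit.1 hred hr hμ0
    (fun hns ↦ absurd hsplit hns) (fun hns ↦ absurd hsplit hns) (fun _ ↦ hlam3)
    (fun _ ↦ ⟨k, h𝓛, hb⟩)

/-- **Route P ⇒ `BSD(E,p)` at a NON-SPLIT multiplicative Eisenstein prime, rank `0`** (through
gen 1's `bsdp_of_mazurMainConjectureAt_of_analyticRank_eq_zero`; modularity `hpar`; all named facts
PUBLISHED, the data finite checks). [cite: GreenbergLNM1716, Prop. 3.10 and §5 p. 183]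
[cite: Wuthrich2014, Thm. 16 (p. 397)] [cite: SteinWuthrich2013, Thm. 6.1 (p. 20)] -/
theorem bsdp_of_lamTwo_of_nonsplit
    (hWu : thm16_charIdeal_dvd_multiplicative_of_reducible)
    (hJs : thm61_splitMultiplicative) (hJn : thm61_nonsplitMultiplicative)
    (hHs : exists_isSplitMultCanonical) (hHn : exists_isMultCanonical)
    (h310 : prop310_selmerCorank_mod_two_eq_lambdaInvariant)
    (hGZK : rank_eq_analyticRank_of_analyticRank_le_one) (hmod : hasEntireLFunction_rat)
    (hpar : nonempty_modularParametrizationData)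
    (W : WeierstrassCurve ℚ) [W.IsElliptic] [W.IsGloballyMinimal] (p : ℕ) [Fact p.Prime]
    (hGS : greenberg_stevens (W := W) (p := p))
    (hp2 : p ≠ 2) (hmult : W.HasMultiplicativeReductionAtPrime p)
    (hns : ¬ W.HasSplitMultiplicativeReductionAtPrime p)
    (hred : ¬ W.HasIrreducibleModPGaloisRep p) (hr : W.analyticRank = 0)
    (hμ0 : AnalyticMuLE W p 0) (hlam2 : AnalyticLambdaEq W p 2)
    (hb : 2 * padicValNat p W.torsionOrder < padicValNat p W.tamagawaProduct) : BSDp W p :=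
  bsdp_of_mazurMainConjectureAt_of_analyticRank_eq_zero hJs hJn hHs hHn hGZK hmod hpar W p hGS hp2
    hmult hr
    (mazurMainConjectureAt_of_lamTwo_of_nonsplit hWu hJs hJn hHs hHn h310 hGZK hmod W p hGS hp2
      hmult hns hred hr hμ0 hlam2 hb)

/-- **Route P ⇒ `BSD(E,p)` at a SPLIT multiplicative Eisenstein prime, rank `0`** (through gen 1's
`bsdp_of_mazurMainConjectureAt_of_analyticRank_eq_zero`). [cite: GreenbergLNM1716, Prop. 3.10 and §5 p. 183]
[cite: Wuthrich2014, Thm. 16 (p. 397)] [cite: SteinWuthrich2013, Thm. 6.1 (p. 20)] -/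
theorem bsdp_of_lamThree_of_split
    (hWu : thm16_charIdeal_dvd_multiplicative_of_reducible)
    (hJs : thm61_splitMultiplicative) (hJn : thm61_nonsplitMultiplicative)
    (hHs : exists_isSplitMultCanonical) (hHn : exists_isMultCanonical)
    (h310 : prop310_selmerCorank_mod_two_eq_lambdaInvariant)
    (hGZK : rank_eq_analyticRank_of_analyticRank_le_one) (hmod : hasEntireLFunction_rat)
    (hpar : nonempty_modularParametrizationData)
    (W : WeierstrassCurve ℚ) [W.IsElliptic] [W.IsGloballyMinimal] (p : ℕ) [Fact p.Prime]
    (hGS : greenberg_stevens (W := W) (p := p))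
    (hp2 : p ≠ 2) (hsplit : W.HasSplitMultiplicativeReductionAtPrime p)
    (hred : ¬ W.HasIrreducibleModPGaloisRep p) (hr : W.analyticRank = 0)
    (hμ0 : AnalyticMuLE W p 0) (hlam3 : AnalyticLambdaEq W p 3)
    {k : ℤ} (h𝓛 : ∀ Dq : TateParameterData W p, k ≤ (LInvariant Dq).valuation)
    (hb : 2 + 2 * (padicValNat p W.torsionOrder : ℤ) ≤ k + padicValNat p W.tamagawaProduct) :
    BSDp W p :=
  bsdp_of_mazurMainConjectureAt_of_analyticRank_eq_zero hJs hJn hHs hHn hGZK hmod hpar W p hGS hp2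
    hsplit.1 hr
    (mazurMainConjectureAt_of_lamThree_of_split hWu hJs hJn hHs hHn h310 hGZK hmod W p hGS hp2
      hsplit hred hr hμ0 hlam3 h𝓛 hb)

/-- **No rational `p`-torsion, non-split prime: `p ∤ #E(ℚ)_tors ∧ p ∣ ∏ c_ℓ ∧ μ_an = 0 ∧ λ_an = 2
⇒ BSD(E,p)`** (the inequality `hb` of `bsdp_of_lamTwo_of_nonsplit` reduces to `ord_p ∏ c_ℓ ≥ 1`).
[cite: GreenbergLNM1716, Prop. 3.10 and §5 p. 183] [cite: Wuthrich2014, Thm. 16 (p. 397)] -/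
theorem bsdp_of_lamTwo_of_nonsplit_of_not_dvd_torsionOrder
    (hWu : thm16_charIdeal_dvd_multiplicative_of_reducible)
    (hJs : thm61_splitMultiplicative) (hJn : thm61_nonsplitMultiplicative)
    (hHs : exists_isSplitMultCanonical) (hHn : exists_isMultCanonical)
    (h310 : prop310_selmerCorank_mod_two_eq_lambdaInvariant)
    (hGZK : rank_eq_analyticRank_of_analyticRank_le_one) (hmod : hasEntireLFunction_rat)
    (hpar : nonempty_modularParametrizationData)
    (W : WeierstrassCurve ℚ) [W.IsElliptic] [W.IsGloballyMinimal] (p : ℕ) [Fact p.Prime]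
    (hGS : greenberg_stevens (W := W) (p := p))
    (hp2 : p ≠ 2) (hmult : W.HasMultiplicativeReductionAtPrime p)
    (hns : ¬ W.HasSplitMultiplicativeReductionAtPrime p)
    (hred : ¬ W.HasIrreducibleModPGaloisRep p) (hr : W.analyticRank = 0)
    (htors : ¬ p ∣ W.torsionOrder) (htam : p ∣ W.tamagawaProduct)
    (hμ0 : AnalyticMuLE W p 0) (hlam2 : AnalyticLambdaEq W p 2) : BSDp W p := by
  refine bsdp_of_lamTwo_of_nonsplit hWu hJs hJn hHs hHn h310 hGZK hmod hpar W p hGS hp2 hmult hns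
    hred hr hμ0 hlam2 ?_
  have h0 : padicValNat p W.torsionOrder = 0 := padicValNat.eq_zero_of_not_dvd htors
  have h1 : 1 ≤ padicValNat p W.tamagawaProduct :=
    one_le_padicValNat_of_dvd (W.tamagawaProduct_pos').ne' htam
  omega

/-- **No rational `p`-torsion, split prime: `p ∤ #E(ℚ)_tors ∧ k ≤ ord_p 𝓛_p ∧ 2 ≤ k + ord_p ∏ c_ℓ ∧
μ_an = 0 ∧ λ_an = 3 ⇒ BSD(E,p)`** (e.g. `k = 1`, `p ∣ ∏ c_ℓ`: the generic case `p ∤ ord_p q_E`,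
`log_p q_E ∉ p²ℤ_p`). [cite: GreenbergLNM1716, Prop. 3.10 and §5 p. 183] [cite: Wuthrich2014, Thm. 16 (p. 397)] -/
theorem bsdp_of_lamThree_of_split_of_not_dvd_torsionOrder
    (hWu : thm16_charIdeal_dvd_multiplicative_of_reducible)
    (hJs : thm61_splitMultiplicative) (hJn : thm61_nonsplitMultiplicative)
    (hHs : exists_isSplitMultCanonical) (hHn : exists_isMultCanonical)
    (h310 : prop310_selmerCorank_mod_two_eq_lambdaInvariant)
    (hGZK : rank_eq_analyticRank_of_analyticRank_le_one) (hmod : hasEntireLFunction_rat)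
    (hpar : nonempty_modularParametrizationData)
    (W : WeierstrassCurve ℚ) [W.IsElliptic] [W.IsGloballyMinimal] (p : ℕ) [Fact p.Prime]
    (hGS : greenberg_stevens (W := W) (p := p))
    (hp2 : p ≠ 2) (hsplit : W.HasSplitMultiplicativeReductionAtPrime p)
    (hred : ¬ W.HasIrreducibleModPGaloisRep p) (hr : W.analyticRank = 0)
    (htors : ¬ p ∣ W.torsionOrder)
    {k : ℤ} (h𝓛 : ∀ Dq : TateParameterData W p, k ≤ (LInvariant Dq).valuation)
    (hk : 2 ≤ k + padicValNat p W.tamagawaProduct)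
    (hμ0 : AnalyticMuLE W p 0) (hlam3 : AnalyticLambdaEq W p 3) : BSDp W p := by
  refine bsdp_of_lamThree_of_split hWu hJs hJn hHs hHn h310 hGZK hmod hpar W p hGS hp2 hsplit hred
    hr hμ0 hlam3 h𝓛 ?_
  have h0 : padicValNat p W.torsionOrder = 0 := padicValNat.eq_zero_of_not_dvd htors
  rw [h0, Nat.cast_zero, mul_zero, add_zero]
  exact hk

end Headline

/-! ### Sub-cell X2b forms -/

section CellB

variable {W : WeierstrassCurve ℚ} [W.IsElliptic] [W.IsGloballyMinimal] {p : ℕ} [Fact p.Prime]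

/-- **Route P on sub-cell X2b: the typed missing input `X2.MissingInputB W p` (Mazur's main
conjecture at the pair) from the route-P data** — `μ_an = 0` and EITHER (non-split) `λ_an = 2 ∧
2·ord_p #tors < ord_p ∏c_ℓ` OR (split) `λ_an = 3 ∧ ∃ k ≤ ord_p 𝓛_p, 2 + 2·ord_p #tors ≤ k + ord_p ∏c_ℓ`.
A per-pair certificate; X2b stays CONSTRUCTION-SHAPED at class level.
[cite: GreenbergLNM1716, Prop. 3.10 and §5 p. 183] [cite: Wuthrich2014, Thm. 16 (p. 397)] -/
theorem missingInputB_of_cellB_of_routeP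
    (hWu : thm16_charIdeal_dvd_multiplicative_of_reducible)
    (hJs : thm61_splitMultiplicative) (hJn : thm61_nonsplitMultiplicative)
    (hHs : exists_isSplitMultCanonical) (hHn : exists_isMultCanonical)
    (h310 : prop310_selmerCorank_mod_two_eq_lambdaInvariant)
    (hGZK : rank_eq_analyticRank_of_analyticRank_le_one) (hmod : hasEntireLFunction_rat)
    (W : WeierstrassCurve ℚ) [W.IsElliptic] [W.IsGloballyMinimal] (p : ℕ) [Fact p.Prime]
    (hGS : greenberg_stevens (W := W) (p := p)) (hc : CellB W p) (hμ0 : AnalyticMuLE W p 0)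
    (hlam2 : ¬ W.HasSplitMultiplicativeReductionAtPrime p → AnalyticLambdaEq W p 2)
    (hbn : ¬ W.HasSplitMultiplicativeReductionAtPrime p →
      2 * padicValNat p W.torsionOrder < padicValNat p W.tamagawaProduct)
    (hlam3 : W.HasSplitMultiplicativeReductionAtPrime p → AnalyticLambdaEq W p 3)
    (hbs : W.HasSplitMultiplicativeReductionAtPrime p → ∃ k : ℤ,
      (∀ Dq : TateParameterData W p, k ≤ (LInvariant Dq).valuation) ∧
        2 + 2 * (padicValNat p W.torsionOrder : ℤ) ≤ k + padicValNat p W.tamagawaProduct) :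
    MissingInputB W p :=
  mazurMainConjectureAt_of_routeP hWu hJs hJn hHs hHn h310 hGZK hmod W p hGS hc.2.1.1 hc.2.1.2.2
    hc.2.1.2.1 hc.1 hμ0 hlam2 hbn hlam3 hbs

/-- **Route P ⇒ `BSD(E,p)` on a sub-cell X2b pair** (either reduction sign; modularity `hpar` for
the final step `MC ⇒ BSD(E,p)`, gen 1). [cite: GreenbergLNM1716, Prop. 3.10 and §5 p. 183]
[cite: Wuthrich2014, Thm. 16 (p. 397)] [cite: SteinWuthrich2013, Thm. 6.1 (p. 20)] -/
theorem cellB_bsdp_of_routeP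
    (hWu : thm16_charIdeal_dvd_multiplicative_of_reducible)
    (hJs : thm61_splitMultiplicative) (hJn : thm61_nonsplitMultiplicative)
    (hHs : exists_isSplitMultCanonical) (hHn : exists_isMultCanonical)
    (h310 : prop310_selmerCorank_mod_two_eq_lambdaInvariant)
    (hGZK : rank_eq_analyticRank_of_analyticRank_le_one) (hmod : hasEntireLFunction_rat)
    (hpar : nonempty_modularParametrizationData)
    (W : WeierstrassCurve ℚ) [W.IsElliptic] [W.IsGloballyMinimal] (p : ℕ) [Fact p.Prime]
    (hGS : greenberg_stevens (W := W) (p := p)) (hc : CellB W p) (hμ0 : AnalyticMuLE W p 0)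
    (hlam2 : ¬ W.HasSplitMultiplicativeReductionAtPrime p → AnalyticLambdaEq W p 2)
    (hbn : ¬ W.HasSplitMultiplicativeReductionAtPrime p →
      2 * padicValNat p W.torsionOrder < padicValNat p W.tamagawaProduct)
    (hlam3 : W.HasSplitMultiplicativeReductionAtPrime p → AnalyticLambdaEq W p 3)
    (hbs : W.HasSplitMultiplicativeReductionAtPrime p → ∃ k : ℤ,
      (∀ Dq : TateParameterData W p, k ≤ (LInvariant Dq).valuation) ∧
        2 + 2 * (padicValNat p W.torsionOrder : ℤ) ≤ k + padicValNat p W.tamagawaProduct) :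
    BSDp W p :=
  bsdp_of_mazurMainConjectureAt_of_analyticRank_eq_zero hJs hJn hHs hHn hGZK hmod hpar W p hGS
    hc.2.1.1 hc.2.1.2.2 hc.1
    (missingInputB_of_cellB_of_routeP hWu hJs hJn hHs hHn h310 hGZK hmod W p hGS hc hμ0 hlam2 hbn
      hlam3 hbs)

/-- **The rank-`0` half of X2 under route P, class-level bookkeeping**: IF every sub-cell X2b pair
carried the route-P data (it does not — `λ_an`-excess `≥ 4` and `hb`-failures occur in the census),
`X2.TargetB` would follow from the PUBLISHED facts. Recorded only to make the shape of the lever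
explicit; nothing is claimed. [cite: GreenbergLNM1716, Prop. 3.10 and §5 p. 183] -/
theorem targetB_of_forall_routeP
    (hWu : thm16_charIdeal_dvd_multiplicative_of_reducible)
    (hJs : thm61_splitMultiplicative) (hJn : thm61_nonsplitMultiplicative)
    (hHs : exists_isSplitMultCanonical) (hHn : exists_isMultCanonical)
    (h310 : prop310_selmerCorank_mod_two_eq_lambdaInvariant)
    (hGZK : rank_eq_analyticRank_of_analyticRank_le_one) (hmod : hasEntireLFunction_rat)
    (hpar : nonempty_modularParametrizationData)
    (hGS : ∀ (W : WeierstrassCurve ℚ) [W.IsElliptic] [W.IsGloballyMinimal] (p : ℕ) [Fact p.Prime],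
      greenberg_stevens (W := W) (p := p))
    (hdata : ∀ (W : WeierstrassCurve ℚ) [W.IsElliptic] [W.IsGloballyMinimal] (p : ℕ) [Fact p.Prime],
      CellB W p → AnalyticMuLE W p 0 ∧
        (¬ W.HasSplitMultiplicativeReductionAtPrime p → AnalyticLambdaEq W p 2 ∧
          2 * padicValNat p W.torsionOrder < padicValNat p W.tamagawaProduct) ∧
        (W.HasSplitMultiplicativeReductionAtPrime p → AnalyticLambdaEq W p 3 ∧ ∃ k : ℤ,
          (∀ Dq : TateParameterData W p, k ≤ (LInvariant Dq).valuation) ∧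
            2 + 2 * (padicValNat p W.torsionOrder : ℤ) ≤ k + padicValNat p W.tamagawaProduct)) :
    TargetB := by
  intro W _ _ p _ hc
  obtain ⟨hμ0, hn, hs⟩ := hdata W p hc
  exact cellB_bsdp_of_routeP hWu hJs hJn hHs hHn h310 hGZK hmod hpar W p (hGS W p) hc hμ0
    (fun h ↦ (hn h).1) (fun h ↦ (hn h).2) (fun h ↦ (hs h).1) (fun h ↦ (hs h).2)

end CellB

end Summit.BirchSwinnertonDyer.Rank1Residual.X2

end
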